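import Summits.BirchSwinnertonDyer.Rank1Residual.Supersingular.SignedMuVanishing
import Literature.NumberTheory.EllipticCurves.GreenbergVatsal2000.CongruentCurves
import Literature.NumberTheory.EllipticCurves.BurungaleTian2026.EtaSignedMainConjectureTensorQ
import HarnessLib

/-!
# Route `PrintX8`, crux `MuBoundSmallImageX8` (stmt-BirchSwinnertonDyer-20622): the ANALYTIC RIDER —
# ONE certified Mazur–Tate layer `μ(θ_n) = 0` gives a colour `•` with `L^•_3(E) ≠ 0`, `μ(L^•) = 0`,
# unit content and `μ(Λ/(L^•)) = 0`; an odd AND an even layer give the Perrin-Riou–Pollack node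
# `SignedMuVanishing W 3` at the pair (cell `bsd-print-x8`, D-0131 (2) print tier, prover seat p3;
# `--supports` 20622, closes nothing)

PARTITION (cell bsd-print-x8, leaf `ClassX8`; the 61 small-image cells of crux 20622 =
`x8_smallimage_61cells.tsv`): types-the-object-of the rider input of the `μ`-transfer line on 20622;
closes NONE; 0 census cells move; BSD is not proved by any of this.

HONEST FRAMING. Rev 8 of route `PrintX8` (planner g2) split the small-image crux 20402 into K1 (19875)
and the `μ`-bound `MuBoundSmallImageX8` (20622, «`μ(X^•) ≤ μ(Λ/(L^•))`», this seat's `hμ` binder).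
The cell's line on 20622 (PLAN v1.2 §2) is an Euler-system `μ`-TRANSFER: p1 g2's
`stub_muTransfer_of_oneColourMuZero` «ONE colour `c'` with `L^{c'} ≠ 0 ∧ μ(Λ/(L^{c'})) = 0` ⇒
`μ(D.X) ≤ μ(Λ/(L^•))` for every colour» (Sprung 2012 Coleman–Kato fact + the reduction-free core), fed
by an ANALYTIC RIDER «some colour has `μ(L^{c'}) = 0`», decidable per pair from Mazur–Tate elements.
THIS file is the rider, as the planner's BC3 `stub_oneColourMuZero` asked of p3 (INBOX 15:37Z) — in fact
SHARPER than asked: ONE layer suffices for one colour, and NO `λ`-range hypothesis is needed: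

* §1 (`Λ`-algebra) `red g ≠ 0` ⇒ `g ≠ 0`, unit content (`hasUnitContent_of_red_ne_zero`), and
  `μ(Λ/(g)) = 0` (`muInvariant_quotient_span_eq_zero_of_red_ne_zero`, the module `μ` of the crux's
  currency; `char(Λ/(g)) = (g)`).
* §2 (THE READING, `λ`-free; `p ≠ 2` good with `p ∣ a_p`, ANY image, ANY rank, `f` the newform, ANY
  Sprung pair). `red_sharp_ne_zero_of_mazurTate_odd` / `red_flat_ne_zero_of_mazurTate_even`: if at an
  ODD (resp. EVEN) layer `n` the Mazur–Tate element `θ_n`, as the element `Θ ∈ Λ` with `ι Θ = θ_n`, is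
  non-zero with `μ(Θ) = 0` — the census's two-engine certificate —, then `L♯` (resp. `L♭`) is
  `≢ 0 (mod p)`. Proof: integrally `Θ = ω_n Q − (u_n L♯ + v_n L♭)` (the tree's
  `exists_integral_mazurTate_of_isSprungPair`, Sprung 2017 Thm. 1.12 / Cor. 4.4), and mod `p`:
  `ω_n ≡ T^{pⁿ}`, `v_n ≡ 0` at odd `n` (`u_n ≡ 0` at even `n`) because `p ∣ a_p` reduces Sprung's
  recursion to the `a_p = 0` one (`red_toIwasawa_flatPoly_of_odd` …); so `L♯ ≡ 0` would give
  `θ̄_n = T^{pⁿ} Q̄`, of order `≥ pⁿ > deg θ_n` (Pollack Def. 6.15), i.e. `θ̄_n = 0` — contradicting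
  `μ(Θ) = 0`. `exists_chromaticL_muZero_of_mazurTate`: ONE layer (any parity) ⇒ `∃ •`, `L^• ≠ 0 ∧
  μ(L^•) = 0 ∧ HasUnitContent(L^•) ∧ μ(Λ/(L^•)) = 0` (all three currencies);
  `forall_chromaticL_muZero_of_mazurTate_odd_even`: an odd and an even layer ⇒ BOTH colours.
* §3 `signedMuVanishing_of_mazurTate_odd_even` (+ `ClassX8.` forms): an odd and an even certified layer
  ⇒ the tree's conjecture node `Supersingular.SignedMuVanishing W p` AT THE PAIR (newform and pair are
  unique) — the two-layer certificate DISCHARGES the Perrin-Riou–Pollack node per pair, beyond the unit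
  case `ClassX8.signedMuVanishing_of_padicValRat_ratPlusSymbol_eq_zero`.
USE (ty3 / p1 g2 / p2 g2): per cell, a kernel certificate `(Θ, hΘ : ι Θ = θ_n, Θ ≠ 0, mu Θ = 0)` at one
layer `n ≥ 1` (b2b engine-B readings `mu/x8_smallimage_mu61.tsv`; the tree's `MazurTateRecords*`
pattern) gives the rider by `ClassX8.exists_chromaticL_muZero_of_mazurTate`. Contrast
`lam_sharp_eq_of_mazurTate` (MazurTateLambdaReading), which reads `λ` too but needs the faithful range.
Beyond-print theorem: NO (Pollack 2003 Props. 6.9–6.10 / Sprung 2017 §3 bookkeeping on the tree's real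
objects). PARTITION: 0 cells.

References: [Pollack2003] Prop. 6.9, 6.10, Def. 6.15; [Sprung2017] §3.1, Cor. 4.4, Thm. 1.12;
[PerrinRiou2003] §6.1 Conj. 6.1.1; [GreenbergVatsal2000] p. 2 (1)–(2); [Washington1997] §13.2; files
`Rank1Residual/Supersingular/{MazurTateReduction,MazurTateLambdaReading,MazurTateLayerConsistency,SignedMuVanishing}.lean`,
`Theses/PrintX8.lean` rev 8 (item 20622), `Theorems/PrintX8SmallImageMuSplit.lean` (p540766).
-/

set_option autoImplicit false
-- justification: the mandated namespace `Summit.BirchSwinnertonDyer.BirchSwinnertonDyer.Theorems`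
-- (single-conjunct summit, Sub = Summit) repeats a segment by design (D-0017).
set_option linter.dupNamespace false

noncomputable section

open scoped Classical MatrixGroups ModularForm

open CongruenceSubgroup Polynomial WeierstrassCurve Literature.NumberTheory.EllipticCurves
  Literature.NumberTheory.EllipticCurves.ModularForms
  Literature.NumberTheory.EllipticCurves.Sprung2017
  Literature.NumberTheory.EllipticCurves.Rank1Residual
  Literature.NumberTheory.EllipticCurves.GreenbergVatsal2000
  Summit.BirchSwinnertonDyer.Rank1Residual.X1.MuLambda
  Summit.BirchSwinnertonDyer.Rank1Residual.Supersingular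

namespace Summit.BirchSwinnertonDyer.BirchSwinnertonDyer.Theorems.PrintX8MazurTateMuRider

/-! ### §1. `Λ`-algebra: from `red g ≠ 0` to the three currencies of «analytic `μ = 0`» -/

section Algebra

variable {p : ℕ} [hp : Fact p.Prime]

/-- `red g ≠ 0` ⇒ `g ≠ 0`. [folklore] -/
theorem ne_zero_of_red_ne_zero {g : IwasawaAlgebra p} (h : red g ≠ 0) : g ≠ 0 := by
  rintro rfl
  exact h (by simp [red])

/-- `red g ≠ 0` ⇒ `g` has unit content (some coefficient is a `p`-adic unit; Greenberg–Vatsal's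
reading (2) of `μ = 0`). [cite: GreenbergVatsal2000, p. 2, (2)] -/
theorem hasUnitContent_of_red_ne_zero {g : IwasawaAlgebra p} (h : red g ≠ 0) : HasUnitContent g :=
  (hasUnitContent_iff_not_C_dvd g).mpr fun hdvd ↦ h ((red_eq_zero_iff g).mpr hdvd)

/-- **`red g ≠ 0` ⇒ `μ(Λ/(g)) = 0`** (the module-side `μ`, `muInvariant`, of the cyclic torsion
module `Λ/(g)`, whose characteristic ideal is `(g)`; unit content ⟺ `μ = 0`, Greenberg–Vatsal (2)).
This is the currency of the crux `MuBoundSmallImageX8` («`μ(D.X) ≤ μ(Λ/(L^•))`»). (The two steps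
«`Λ/(g)` is torsion» and «unit content ⇒ `μ(Λ/(g)) = 0`» are the tree's
`EtaFineRoad.isTorsion_quotient_span_singleton` / `…muInvariant_quotient_span_eq_zero_of_hasUnitContent`,
inlined here to keep this module's imports route-independent.)
[cite: GreenbergVatsal2000, p. 2, (1)–(2)] [cite: Washington1997, §13.2] -/
theorem muInvariant_quotient_span_eq_zero_of_red_ne_zero {g : IwasawaAlgebra p} (h : red g ≠ 0) :
    muInvariant p (IwasawaAlgebra p ⧸ Ideal.span {g}) = 0 := by
  have hg0 : g ≠ 0 := ne_zero_of_red_ne_zero h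
  have htors : Module.IsTorsion (IwasawaAlgebra p) (IwasawaAlgebra p ⧸ Ideal.span {g}) := by
    intro x
    refine ⟨⟨g, mem_nonZeroDivisors_of_ne_zero hg0⟩, ?_⟩
    obtain ⟨r, rfl⟩ := Ideal.Quotient.mk_surjective x
    change g • Ideal.Quotient.mk (Ideal.span {g}) r = 0
    rw [← Ideal.Quotient.mk_eq_mk, ← Submodule.Quotient.mk_smul, Submodule.Quotient.mk_eq_zero,
      smul_eq_mul]
    exact Ideal.mul_mem_right r _ (Ideal.mem_span_singleton_self g)
  exact (muInvariant_eq_zero_iff_hasUnitContent (IwasawaAlgebra p ⧸ Ideal.span {g}) htors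
    (BurungaleTian2026.charIdeal_quotient_span_singleton hg0)).mpr (hasUnitContent_of_red_ne_zero h)

end Algebra

/-! ### §2. THE READING, `λ`-free: one Mazur–Tate layer with `μ(θ_n) = 0` ⇒ `red L^• ≠ 0` for the
colour of that parity (`♯` ↔ odd, `♭` ↔ even), at ANY good prime with `p ∣ a_p` (any image) -/

section Reading

variable {W : WeierstrassCurve ℚ} [W.IsElliptic] [W.IsGloballyMinimal] {N : ℕ} [NeZero N]
  {f : CuspForm (Gamma0 N) 2} {p : ℕ} [hp : Fact p.Prime]

/-- **Odd layer ⇒ `red L♯ ≠ 0`.** For `p ≠ 2` good with `p ∣ a_p`, `f` the newform of `E = W`, ANY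
Sprung pair `(L♯, L♭)` and an ODD `n`: if the Mazur–Tate element `θ_n`, as the element `Θ ∈ Λ` with
`ι Θ = θ_n` (it exists, `exists_integral_mazurTate_of_isSprungPair`), is non-zero with `μ(Θ) = 0` — a
two-engine certificate of the census — then `L♯ ≢ 0 (mod p)`. Proof: `Θ = ω_n Q − (u_n L♯ + v_n L♭)`
integrally (Sprung 2017 Cor. 4.4 / Thm. 1.12 in the tree), `v_n ≡ 0`, `ω_n ≡ T^{pⁿ} (mod p)`; if also
`L♯ ≡ 0` then `θ̄_n = T^{pⁿ} Q̄` has order `≥ pⁿ > deg θ_n`, so `θ̄_n = 0`, contradicting `μ(Θ) = 0`.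
NO `λ`-range hypothesis (contrast `lam_sharp_eq_of_mazurTate`, which also reads `λ`).
[cite: Pollack2003, Prop. 6.9, Prop. 6.10 and Def. 6.15] [cite: Sprung2017, §3.1, Cor. 4.4 and Thm. 1.12] -/
theorem red_sharp_ne_zero_of_mazurTate_odd (hp2 : p ≠ 2) (hf : IsNewformOf W f)
    (hgood : W.HasGoodReductionAtPrime p) (hap : (p : ℤ) ∣ W.frobeniusTrace p)
    {Lsharp Lflat : IwasawaAlgebra p} (hSP : IsSprungPair f p (W.frobeniusTrace p) Lsharp Lflat)
    {n : ℕ} (hn : Odd n) {Θ : IwasawaAlgebra p}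
    (hΘ : iwasawaToPowerSeries p Θ =
      ((mazurTateElement f p n).map (algebraMap ℚ ℚ_[p]) : PowerSeries ℚ_[p]))
    (hΘ0 : Θ ≠ 0) (hμ : mu Θ = 0) : red Lsharp ≠ 0 := by
  obtain ⟨Q, hQ⟩ := exists_integral_mazurTate_of_isSprungPair hp2 hf hgood hap hSP n
  have hΘeq := iwasawaToPowerSeries_injective p (hΘ.trans hQ)
  intro hredA
  have hred : red Θ = PowerSeries.X ^ (p ^ n) * red Q + 0 * red Lsharp := by
    rw [hΘeq, red, map_sub, map_mul, map_add, map_mul, map_mul]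
    change red (toIwasawa p (cyclotomicOmega p n)) * red Q -
        (red (toIwasawa p (sharpPoly (W.frobeniusTrace p) p n)) * red Lsharp +
          red (toIwasawa p (flatPoly (W.frobeniusTrace p) p n)) * red Lflat) = _
    rw [red_toIwasawa_cyclotomicOmega, red_toIwasawa_flatPoly_of_odd hap hn, hredA, mul_zero,
      zero_mul, add_zero, sub_zero, mul_zero, add_zero]
  have hord : ((p ^ n : ℕ) : ℕ∞) ≤ (red Θ).order :=
    le_order_of_eq_X_pow_mul_add_of_le hred (by rw [zero_mul, PowerSeries.order_zero]; exact le_top)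
  have hred0 : red Θ = 0 :=
    eq_zero_of_le_order_of_coeff_eq_zero hord fun i hi ↦ by
      rw [red, PowerSeries.coeff_map, coeff_eq_zero_of_iwasawaToPowerSeries_eq hΘ hi, map_zero]
  exact red_ne_zero_of_mu_eq_zero hΘ0 hμ hred0

/-- **Even layer ⇒ `red L♭ ≠ 0`** (same, with `u_n ≡ 0 (mod p)` at even `n`).
[cite: Pollack2003, Prop. 6.9, Prop. 6.10 and Def. 6.15] [cite: Sprung2017, §3.1, Cor. 4.4 and Thm. 1.12] -/
theorem red_flat_ne_zero_of_mazurTate_even (hp2 : p ≠ 2) (hf : IsNewformOf W f)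
    (hgood : W.HasGoodReductionAtPrime p) (hap : (p : ℤ) ∣ W.frobeniusTrace p)
    {Lsharp Lflat : IwasawaAlgebra p} (hSP : IsSprungPair f p (W.frobeniusTrace p) Lsharp Lflat)
    {n : ℕ} (hn : Even n) {Θ : IwasawaAlgebra p}
    (hΘ : iwasawaToPowerSeries p Θ =
      ((mazurTateElement f p n).map (algebraMap ℚ ℚ_[p]) : PowerSeries ℚ_[p]))
    (hΘ0 : Θ ≠ 0) (hμ : mu Θ = 0) : red Lflat ≠ 0 := by
  obtain ⟨Q, hQ⟩ := exists_integral_mazurTate_of_isSprungPair hp2 hf hgood hap hSP n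
  have hΘeq := iwasawaToPowerSeries_injective p (hΘ.trans hQ)
  intro hredB
  have hred : red Θ = PowerSeries.X ^ (p ^ n) * red Q + 0 * red Lflat := by
    rw [hΘeq, red, map_sub, map_mul, map_add, map_mul, map_mul]
    change red (toIwasawa p (cyclotomicOmega p n)) * red Q -
        (red (toIwasawa p (sharpPoly (W.frobeniusTrace p) p n)) * red Lsharp +
          red (toIwasawa p (flatPoly (W.frobeniusTrace p) p n)) * red Lflat) = _
    rw [red_toIwasawa_cyclotomicOmega, red_toIwasawa_sharpPoly_of_even hap hn, hredB, mul_zero,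
      zero_mul, zero_add, sub_zero, mul_zero, add_zero]
  have hord : ((p ^ n : ℕ) : ℕ∞) ≤ (red Θ).order :=
    le_order_of_eq_X_pow_mul_add_of_le hred (by rw [zero_mul, PowerSeries.order_zero]; exact le_top)
  have hred0 : red Θ = 0 :=
    eq_zero_of_le_order_of_coeff_eq_zero hord fun i hi ↦ by
      rw [red, PowerSeries.coeff_map, coeff_eq_zero_of_iwasawaToPowerSeries_eq hΘ hi, map_zero]
  exact red_ne_zero_of_mu_eq_zero hΘ0 hμ hred0

/-- **ONE certified layer (any parity) ⇒ a colour `•` with `L^• ≠ 0`, `μ(L^•) = 0` (power-series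
`μ`), unit content, and `μ(Λ/(L^•)) = 0` (module `μ`)** — the analytic rider of the crux
`MuBoundSmallImageX8` in all three currencies: `♯` if `n` is odd, `♭` if `n` is even. For `p ≠ 2` good
with `p ∣ a_p` (ANY `3`-adic image, any rank), `f` the newform, ANY Sprung pair.
[cite: Pollack2003, Prop. 6.9 and Prop. 6.10] [cite: Sprung2017, §3.1, Cor. 4.4 and Thm. 1.12]
[cite: GreenbergVatsal2000, p. 2, (1)–(2)] -/
theorem exists_chromaticL_muZero_of_mazurTate (hp2 : p ≠ 2) (hf : IsNewformOf W f)
    (hgood : W.HasGoodReductionAtPrime p) (hap : (p : ℤ) ∣ W.frobeniusTrace p)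
    {Lsharp Lflat : IwasawaAlgebra p} (hSP : IsSprungPair f p (W.frobeniusTrace p) Lsharp Lflat)
    {n : ℕ} {Θ : IwasawaAlgebra p}
    (hΘ : iwasawaToPowerSeries p Θ =
      ((mazurTateElement f p n).map (algebraMap ℚ ℚ_[p]) : PowerSeries ℚ_[p]))
    (hΘ0 : Θ ≠ 0) (hμ : mu Θ = 0) :
    ∃ c : Chroma, chromaticL c Lsharp Lflat ≠ 0 ∧ mu (chromaticL c Lsharp Lflat) = 0 ∧
      HasUnitContent (chromaticL c Lsharp Lflat) ∧
      muInvariant p (IwasawaAlgebra p ⧸ Ideal.span {chromaticL c Lsharp Lflat}) = 0 := by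
  rcases Nat.even_or_odd n with hn | hn
  · have h := red_flat_ne_zero_of_mazurTate_even hp2 hf hgood hap hSP hn hΘ hΘ0 hμ
    exact ⟨.flat, ne_zero_of_red_ne_zero h, (mu_eq_zero_and_lam_eq_of_red_ne_zero h).1,
      hasUnitContent_of_red_ne_zero h,
      muInvariant_quotient_span_eq_zero_of_red_ne_zero h⟩
  · have h := red_sharp_ne_zero_of_mazurTate_odd hp2 hf hgood hap hSP hn hΘ hΘ0 hμ
    exact ⟨.sharp, ne_zero_of_red_ne_zero h, (mu_eq_zero_and_lam_eq_of_red_ne_zero h).1,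
      hasUnitContent_of_red_ne_zero h,
      muInvariant_quotient_span_eq_zero_of_red_ne_zero h⟩

/-- **An odd AND an even certified layer ⇒ BOTH colours: `L♯, L♭ ≠ 0`, `μ(L♯) = μ(L♭) = 0`,
unit content, `μ(Λ/(L♯)) = μ(Λ/(L♭)) = 0`** (for the given Sprung pair). [cite: Pollack2003, Prop. 6.9 and Prop. 6.10]
[cite: Sprung2017, §3.1, Cor. 4.4 and Thm. 1.12] [cite: GreenbergVatsal2000, p. 2, (1)–(2)] -/
theorem forall_chromaticL_muZero_of_mazurTate_odd_even (hp2 : p ≠ 2) (hf : IsNewformOf W f)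
    (hgood : W.HasGoodReductionAtPrime p) (hap : (p : ℤ) ∣ W.frobeniusTrace p)
    {Lsharp Lflat : IwasawaAlgebra p} (hSP : IsSprungPair f p (W.frobeniusTrace p) Lsharp Lflat)
    {n m : ℕ} (hn : Odd n) (hm : Even m) {Θ Θ' : IwasawaAlgebra p}
    (hΘ : iwasawaToPowerSeries p Θ =
      ((mazurTateElement f p n).map (algebraMap ℚ ℚ_[p]) : PowerSeries ℚ_[p]))
    (hΘ0 : Θ ≠ 0) (hμ : mu Θ = 0)
    (hΘ' : iwasawaToPowerSeries p Θ' =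
      ((mazurTateElement f p m).map (algebraMap ℚ ℚ_[p]) : PowerSeries ℚ_[p]))
    (hΘ'0 : Θ' ≠ 0) (hμ' : mu Θ' = 0) (c : Chroma) :
    chromaticL c Lsharp Lflat ≠ 0 ∧ mu (chromaticL c Lsharp Lflat) = 0 ∧
      HasUnitContent (chromaticL c Lsharp Lflat) ∧
      muInvariant p (IwasawaAlgebra p ⧸ Ideal.span {chromaticL c Lsharp Lflat}) = 0 := by
  have hs := red_sharp_ne_zero_of_mazurTate_odd hp2 hf hgood hap hSP hn hΘ hΘ0 hμ
  have hfl := red_flat_ne_zero_of_mazurTate_even hp2 hf hgood hap hSP hm hΘ' hΘ'0 hμ'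
  cases c with
  | sharp =>
    exact ⟨ne_zero_of_red_ne_zero hs, (mu_eq_zero_and_lam_eq_of_red_ne_zero hs).1,
      hasUnitContent_of_red_ne_zero hs,
      muInvariant_quotient_span_eq_zero_of_red_ne_zero hs⟩
  | flat =>
    exact ⟨ne_zero_of_red_ne_zero hfl, (mu_eq_zero_and_lam_eq_of_red_ne_zero hfl).1,
      hasUnitContent_of_red_ne_zero hfl,
      muInvariant_quotient_span_eq_zero_of_red_ne_zero hfl⟩

end Reading

/-! ### §3. The node and class X8 -/

section Node

variable {W : WeierstrassCurve ℚ} [W.IsElliptic] [W.IsGloballyMinimal] {p : ℕ} [hp : Fact p.Prime]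
  [NeZero (W.conductorNorm ℤ)] {f₀ : CuspForm (Gamma0 (W.conductorNorm ℤ)) 2}

/-- **Two consecutive certified Mazur–Tate layers ⇒ the Perrin-Riou–Pollack node `SignedMuVanishing W p`**
(`μ(L♯) = μ(L♭) = 0`, both non-zero, for the newform at the conductor level and EVERY Sprung pair — the
pair is unique, `IsSprungPair.unique`; the newform is unique, `IsNewformOf.unique`). For `p ≠ 2` good
with `p ∣ a_p` (X6/X7/X8, any image): the census's two-engine layer certificates `(θ_n ≠ 0, μ(θ_n) = 0)`
at ONE odd and ONE even layer DISCHARGE the node at the pair — beyond the unit case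
`ClassX8.signedMuVanishing_of_padicValRat_ratPlusSymbol_eq_zero`. PER PAIR (certificate binders).
[cite: PerrinRiou2003, §6.1 Conjecture 6.1.1] [cite: Pollack2003, Prop. 6.9 and Prop. 6.10]
[cite: Sprung2017, §3.1, Cor. 4.4 and Thm. 1.12] -/
theorem signedMuVanishing_of_mazurTate_odd_even (hp2 : p ≠ 2) (hf₀ : IsNewformOf W f₀)
    (hgood : W.HasGoodReductionAtPrime p) (hap : (p : ℤ) ∣ W.frobeniusTrace p)
    {Lsharp Lflat : IwasawaAlgebra p} (hSP : IsSprungPair f₀ p (W.frobeniusTrace p) Lsharp Lflat)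
    {n m : ℕ} (hn : Odd n) (hm : Even m) {Θ Θ' : IwasawaAlgebra p}
    (hΘ : iwasawaToPowerSeries p Θ =
      ((mazurTateElement f₀ p n).map (algebraMap ℚ ℚ_[p]) : PowerSeries ℚ_[p]))
    (hΘ0 : Θ ≠ 0) (hμ : mu Θ = 0)
    (hΘ' : iwasawaToPowerSeries p Θ' =
      ((mazurTateElement f₀ p m).map (algebraMap ℚ ℚ_[p]) : PowerSeries ℚ_[p]))
    (hΘ'0 : Θ' ≠ 0) (hμ' : mu Θ' = 0) : SignedMuVanishing W p := by
  intro _ f hf Ls Lf hSP' c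
  obtain rfl : f = f₀ := hf.unique hf₀
  obtain ⟨h1, h2⟩ := hSP'.unique hap hSP
  subst h1 h2
  obtain ⟨hne, hmu, -, -⟩ := forall_chromaticL_muZero_of_mazurTate_odd_even hp2 hf₀ hgood hap hSP' hn
    hm hΘ hΘ0 hμ hΘ' hΘ'0 hμ' c
  exact ⟨hne, hmu⟩

omit [NeZero (W.conductorNorm ℤ)] in
/-- **Class X8 reading (`p = 3`, good supersingular, `a_3 = ±3`; ANY image, any rank): one certified
Mazur–Tate layer at `3` ⇒ a colour `•` with `L^•_3(E) ≠ 0`, `μ(L^•) = 0`, unit content and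
`μ(Λ/(L^•)) = 0`** — the `(hX : ClassX8 W p)`-headed form for the 61 small-image cells of crux
`MuBoundSmallImageX8` (the rider that the Euler-system `μ`-transfer consumes). PER PAIR.
[cite: Pollack2003, Prop. 6.9 and Prop. 6.10] [cite: Sprung2017, §3.1, Cor. 4.4 and Thm. 1.12] [cite: GreenbergVatsal2000, p. 2, (1)–(2)] -/
theorem ClassX8.exists_chromaticL_muZero_of_mazurTate (hX : ClassX8 W p)
    {N : ℕ} [NeZero N] {f : CuspForm (Gamma0 N) 2} (hf : IsNewformOf W f)
    {Lsharp Lflat : IwasawaAlgebra p} (hSP : IsSprungPair f p (W.frobeniusTrace p) Lsharp Lflat)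
    {n : ℕ} {Θ : IwasawaAlgebra p}
    (hΘ : iwasawaToPowerSeries p Θ =
      ((mazurTateElement f p n).map (algebraMap ℚ ℚ_[p]) : PowerSeries ℚ_[p]))
    (hΘ0 : Θ ≠ 0) (hμ : mu Θ = 0) :
    ∃ c : Chroma, chromaticL c Lsharp Lflat ≠ 0 ∧ mu (chromaticL c Lsharp Lflat) = 0 ∧
      HasUnitContent (chromaticL c Lsharp Lflat) ∧
      muInvariant p (IwasawaAlgebra p ⧸ Ideal.span {chromaticL c Lsharp Lflat}) = 0 := by
  obtain ⟨hp3, hss, -⟩ := hX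
  subst hp3
  exact exists_chromaticL_muZero_of_mazurTate (by decide) hf hss.1 hss.2 hSP hΘ hΘ0 hμ

/-- **Class X8: an odd and an even certified layer at `3` ⇒ `SignedMuVanishing W 3`** (the
Perrin-Riou–Pollack node at the pair, both colours). PER PAIR. [cite: PerrinRiou2003, §6.1 Conjecture 6.1.1]
[cite: Pollack2003, Prop. 6.9 and Prop. 6.10] [cite: Sprung2017, §3.1, Cor. 4.4 and Thm. 1.12] -/
theorem ClassX8.signedMuVanishing_of_mazurTate_odd_even (hX : ClassX8 W p) (hf₀ : IsNewformOf W f₀)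
    {Lsharp Lflat : IwasawaAlgebra p} (hSP : IsSprungPair f₀ p (W.frobeniusTrace p) Lsharp Lflat)
    {n m : ℕ} (hn : Odd n) (hm : Even m) {Θ Θ' : IwasawaAlgebra p}
    (hΘ : iwasawaToPowerSeries p Θ =
      ((mazurTateElement f₀ p n).map (algebraMap ℚ ℚ_[p]) : PowerSeries ℚ_[p]))
    (hΘ0 : Θ ≠ 0) (hμ : mu Θ = 0)
    (hΘ' : iwasawaToPowerSeries p Θ' =
      ((mazurTateElement f₀ p m).map (algebraMap ℚ ℚ_[p]) : PowerSeries ℚ_[p]))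
    (hΘ'0 : Θ' ≠ 0) (hμ' : mu Θ' = 0) : SignedMuVanishing W p := by
  have hp3 : p = 3 := hX.1
  have hss : GoodSS W 3 := hX.2.1
  subst hp3
  intro _ f hf Ls Lf hSP' c
  obtain rfl : f = f₀ := hf.unique hf₀
  obtain ⟨h1, h2⟩ := hSP'.unique hss.2 hSP
  subst h1 h2
  obtain ⟨hne, hmu, -, -⟩ := forall_chromaticL_muZero_of_mazurTate_odd_even (by decide) hf₀ hss.1
    hss.2 hSP' hn hm hΘ hΘ0 hμ hΘ' hΘ'0 hμ' c
  exact ⟨hne, hmu⟩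

end Node

end Summit.BirchSwinnertonDyer.BirchSwinnertonDyer.Theorems.PrintX8MazurTateMuRider

end
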